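import Summits.BirchSwinnertonDyer.BirchSwinnertonDyer.Theses.BiquadraticEisensteinDescent
import Literature.NumberTheory.EllipticCurves.HeegnerPoints
import HarnessLib

set_option linter.dupNamespace false
set_option autoImplicit false

/-!
# Sketch (crux-ideate seat 1, g24, round 1) — first lemmas for the crux idea
# `disjoint-divisibility-pigeonhole` on `HeegnerTwistCouplingInSupply` (stmt-BirchSwinnertonDyer-21381)

Lever: for a fixed twist-core level `N₀` and height `Y`, the classes
`S_p(Y) = {d Heegner for N₀, |d| ≤ Y : p ∣ h(d)}` are, for the primes `p` of one dyadic block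
`[P, 2P]`, almost disjoint: a class number `h(d) < Y` has at most `log h(d) / log P` prime factors
`≥ P` (`primesDividingInBlock_card_le`, proved).  Double counting (`blockDoubleCount`) bounds the
number of POPULAR primes (`Popular`: `p ∣ h(d)` for at least a `τ`-fraction of the ambient Heegner
discriminants) by `(log Y / log P) / τ`.  An effective, LEVEL-UNIFORM non-vanishing count for the
Heegner quadratic twists of the corner curve (`LevelUniformNonvanishingCount A B`, the L-side input,
NOT in print in this uniformity) then gives the crux conclusion for every non-popular `p` by
pigeonhole (`pigeonholeTransferShape`), i.e. for all but `≪ A (log Y)^{B+1}` primes `p ∈ [P,2P]`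
(`exceptionalSetShape`).  The residual for an individual `p` is `¬ Popular` (a Cohen–Lenstra-type
upper-density statement, open).  Nothing below is asserted as true except the two proved counting
lemmas; BSD is not proved by any of this.
-/

noncomputable section

open scoped NumberField Classical
open WeierstrassCurve NumberField
open Literature.NumberTheory.EllipticCurves

namespace Summit.BirchSwinnertonDyer.BirchSwinnertonDyer.Cruxes.HeegnerTwistCouplingInSupply.SeatOneG24

/-! ## Elementary disjointness (S2) -/

/-- A positive integer `h` has at most `log_P h` prime divisors in the block `[P, 2P]`
(indeed at most `log_P h` prime divisors `≥ P`): their product divides `h` and is `≥ P^{#}`. -/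
theorem primesDividingInBlock_card_le (P h : ℕ) (hP : 2 ≤ P) (hh : 0 < h) :
    ((Finset.Icc P (2 * P)).filter (fun q => q.Prime ∧ q ∣ h)).card ≤ Nat.log P h := by
  set S := (Finset.Icc P (2 * P)).filter (fun q => q.Prime ∧ q ∣ h) with hS
  have hprime : ∀ q ∈ S, Prime q := by
    intro q hq
    simp only [hS, Finset.mem_filter] at hq
    exact Nat.prime_iff.mp hq.2.1
  have hdvd : ∀ q ∈ S, q ∣ h := by
    intro q hq
    simp only [hS, Finset.mem_filter] at hq
    exact hq.2.2
  have hge : ∀ q ∈ S, P ≤ q := by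
    intro q hq
    simp only [hS, Finset.mem_filter, Finset.mem_Icc] at hq
    exact hq.1.1
  have hprod_dvd : (∏ q ∈ S, q) ∣ h := Finset.prod_primes_dvd h hprime hdvd
  have hprod_le : (∏ q ∈ S, q) ≤ h := Nat.le_of_dvd hh hprod_dvd
  have hpow_le : P ^ S.card ≤ ∏ q ∈ S, q := Finset.pow_card_le_prod S (fun q => q) P hge
  have hP1 : 1 < P := by omega
  exact Nat.le_log_of_pow_le hP1 (le_trans hpow_le hprod_le)

/-- Double counting over a dyadic block: if every `d ∈ A` carries a positive "class number"
`hf d` with `log_P (hf d) ≤ L`, then `∑_{P ≤ q ≤ 2P prime} #{d ∈ A : q ∣ hf d} ≤ L · #A`. -/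
theorem blockDoubleCount (A : Finset ℤ) (hf : ℤ → ℕ) (P L : ℕ) (hP : 2 ≤ P)
    (hpos : ∀ d ∈ A, 0 < hf d) (hlog : ∀ d ∈ A, Nat.log P (hf d) ≤ L) :
    ∑ q ∈ (Finset.Icc P (2 * P)).filter Nat.Prime, (A.filter (fun d => q ∣ hf d)).card
      ≤ L * A.card := by
  have key : ∀ q ∈ (Finset.Icc P (2 * P)).filter Nat.Prime,
      (A.filter (fun d => q ∣ hf d)).card = ∑ d ∈ A, if q ∣ hf d then 1 else 0 := by
    intro q _
    rw [Finset.card_filter]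
  rw [Finset.sum_congr rfl key, Finset.sum_comm]
  have bound : ∀ d ∈ A,
      (∑ q ∈ (Finset.Icc P (2 * P)).filter Nat.Prime, if q ∣ hf d then 1 else 0) ≤ L := by
    intro d hd
    rw [← Finset.card_filter]
    have : ((Finset.Icc P (2 * P)).filter Nat.Prime).filter (fun q => q ∣ hf d)
        = (Finset.Icc P (2 * P)).filter (fun q => q.Prime ∧ q ∣ hf d) := by
      rw [Finset.filter_filter]
    rw [this]
    exact le_trans (primesDividingInBlock_card_le P (hf d) hP (hpos d hd)) (hlog d hd)
  calc ∑ d ∈ A, ∑ q ∈ (Finset.Icc P (2 * P)).filter Nat.Prime, (if q ∣ hf d then 1 else 0)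
      ≤ ∑ d ∈ A, L := Finset.sum_le_sum bound
    _ = L * A.card := by rw [Finset.sum_const, smul_eq_mul, mul_comm]

/-! ## The objects of the line (discriminant-indexed predicates matching the crux binders) -/

/-- `d` is the discriminant of an imaginary quadratic field with `|d| > 4` satisfying the Heegner
hypothesis for `N` (every prime of `N` splits). -/
def IsHeegnerDisc (N : ℕ) (d : ℤ) : Prop :=
  ∃ (K : Type) (_ : Field K) (_ : NumberField K),
    IsImaginaryQuadratic K ∧ NumberField.discr K = d ∧ 4 < d.natAbs ∧ SatisfiesHeegnerHypothesis N K

/-- `p` divides the class number of the imaginary quadratic field of discriminant `d`. -/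
def IsDivisibleDisc (p : ℕ) (d : ℤ) : Prop :=
  ∃ (K : Type) (_ : Field K) (_ : NumberField K),
    IsImaginaryQuadratic K ∧ NumberField.discr K = d ∧ p ∣ NumberField.classNumber K

/-- The crux conclusion for `(W, p)` realised at the discriminant `d`. -/
def IsCouplingDisc (W : WeierstrassCurve ℚ) [W.IsElliptic] (p : ℕ) (d : ℤ) : Prop :=
  ∃ (K : Type) (_ : Field K) (_ : NumberField K),
    IsImaginaryQuadratic K ∧ NumberField.discr K = d ∧ 4 < d.natAbs ∧
    SatisfiesHeegnerHypothesis (W.conductorNorm ℤ) K ∧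
    (W.quadraticTwist (d : ℚ)).entireLFunction 1 ≠ 0 ∧ ¬ p ∣ NumberField.classNumber K

/-- Ambient set `A_N(Y)`: Heegner discriminants for `N` with `|d| ≤ Y` (as a finset of `d ∈ [-Y, -5]`). -/
def ambient (N Y : ℕ) : Finset ℤ :=
  (Finset.Icc (-(Y : ℤ)) (-5)).filter (fun d => IsHeegnerDisc N d)

/-- `S_p ∩ A_N(Y)`: the `p`-divisible members of the ambient set. -/
def divisibleIn (N Y p : ℕ) : Finset ℤ :=
  (ambient N Y).filter (fun d => IsDivisibleDisc p d)

/-- Non-vanishing members of `A_N(Y)` for the curve `W` (`N` will be `W.conductorNorm ℤ`). -/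
def nonvanishingIn (W : WeierstrassCurve ℚ) [W.IsElliptic] (N Y : ℕ) : Finset ℤ :=
  (ambient N Y).filter (fun d => (W.quadraticTwist (d : ℚ)).entireLFunction 1 ≠ 0)

/-- `p` is `τ`-POPULAR at height `Y` for the twist-core level `N₀`: at least a `τ`-fraction of the
ambient Heegner discriminants for `N₀` below `Y` have `p ∣ h(d)`.  (Cohen–Lenstra predicts the
fraction `≈ 1/p`; `¬ Popular` for the given `p` is the h-side residual of the line.) -/
def Popular (N₀ Y p : ℕ) (τ : ℝ) : Prop :=
  τ * ((ambient N₀ Y).card : ℝ) ≤ ((divisibleIn N₀ Y p).card : ℝ)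

/-- S1 — the L-side input (NOT in print level-uniformly): there are `A, B` such that for every
corner-type curve `W` of conductor `N` and every `Y ≥ N^A`, at least a `(log Y)^{-B}`-fraction of the
Heegner discriminants for `N` below `Y` are non-vanishing twists.  (Routes: level-uniform first
moment + level-uniform sharp second moment; or, in the `j = 1728` corner, Tian–Yuan–Zhang's genus
criterion + Rédei-matrix statistics.) -/
def LevelUniformNonvanishingCount (A B : ℕ) : Prop :=
  ∀ (W : WeierstrassCurve ℚ) [W.IsElliptic] [W.IsGloballyMinimal] [NeZero (W.conductorNorm ℤ)],
    W.HasCM → W.analyticRank = 1 →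
    ∀ Y : ℕ, (W.conductorNorm ℤ) ^ A ≤ Y →
      ((ambient (W.conductorNorm ℤ) Y).card : ℝ) / (Real.log Y) ^ B
        ≤ ((nonvanishingIn W (W.conductorNorm ℤ) Y).card : ℝ)

/-- The pigeonhole transfer (shape of the line's composition; routine once the two counting facts
`#nonvanishing > #divisible` inside the SAME ambient set are available): a non-popular prime at a
height where S1 applies yields a coupling discriminant.  Here `N₀` is any level with
`ambient N Y ⊆ ambient N₀ Y` (the twist-core level: Heegner for `N = N₀ p²` implies Heegner for `N₀`). -/
def pigeonholeTransferShape (A B : ℕ) : Prop :=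
  LevelUniformNonvanishingCount A B →
  ∀ (W : WeierstrassCurve ℚ) [W.IsElliptic] [W.IsGloballyMinimal] [NeZero (W.conductorNorm ℤ)]
    (p N₀ Y : ℕ), W.HasCM → W.analyticRank = 1 → (W.conductorNorm ℤ) ^ A ≤ Y →
    (∀ d ∈ ambient (W.conductorNorm ℤ) Y, d ∈ ambient N₀ Y) →
    ((divisibleIn N₀ Y p).card : ℝ) < ((ambient (W.conductorNorm ℤ) Y).card : ℝ) / (Real.log Y) ^ B →
    ∃ d : ℤ, IsCouplingDisc W p d

/-- The exceptional-set theorem shape (S2 ⇒): for any level `N₀`, height `Y ≥ 2` and block `[P,2P]`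
with `P ≥ 2`, the number of `τ`-popular primes in the block is at most `(log Y / log P + 1) / τ`
(from `blockDoubleCount` with `hf d = h(d) ≤ Y`, i.e. `log_P h(d) ≤ log Y / log P`). -/
def exceptionalSetShape : Prop :=
  ∀ (N₀ Y P : ℕ) (τ : ℝ), 2 ≤ P → 2 ≤ Y → 0 < τ →
    ((((Finset.Icc P (2 * P)).filter Nat.Prime).filter (fun p => Popular N₀ Y p τ)).card : ℝ)
      ≤ (Real.log Y / Real.log P + 1) / τ

/-- What the line proves modulo S1 (all but polylog-many primes per dyadic block), stated for a
fixed twist-core: for every `p ∈ [P, 2P]` outside an exceptional set of size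
`≤ (A·log(N₀(2P)²) / log P + 1)·(log Y)^B`, every corner curve `W` of conductor `N₀ p²` admits a
coupling discriminant.  The ∀-crux additionally needs `¬ Popular N₀ Y p ((log Y)^{-B})` for the GIVEN `p`. -/
def almostAllPrimesShape (A B : ℕ) : Prop :=
  ∀ (N₀ P : ℕ), 2 ≤ P → 0 < N₀ →
    ∃ E : Finset ℕ, (E.card : ℝ) ≤
        (↑A * Real.log (↑N₀ * (2 * ↑P) ^ 2) / Real.log P + 1) * (Real.log ((↑N₀ * (2 * ↑P) ^ 2) ^ A)) ^ B ∧
      ∀ (W : WeierstrassCurve ℚ) [W.IsElliptic] [W.IsGloballyMinimal] [NeZero (W.conductorNorm ℤ)]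
        (p : ℕ) [Fact p.Prime], W.HasCM → W.analyticRank = 1 → P ≤ p → p ≤ 2 * P → p ∉ E →
        W.conductorNorm ℤ = N₀ * p ^ 2 → ∃ d : ℤ, IsCouplingDisc W p d

end Summit.BirchSwinnertonDyer.BirchSwinnertonDyer.Cruxes.HeegnerTwistCouplingInSupply.SeatOneG24
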